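/-
Copyright (c) 2026 the pub-hodgecm-mathlib formalisation cell (harness21).  Prover seat hodgecm-mathlib-F0P3a-p05 (g18): road «S3-ram» (LEAD F0P3a-plan (g13); (Cnt2′) chair
F0P3a-p07 (g15) RULING (16)(b) «REGIME A-EVEN HYPERBOLIC»; (α) keeper F0P3a-p06 (g16)); the TOP-vertex corollary of A-p12 (g25)'s ★ (K4a) 3/3, handed over 05:07Z; 2026-09-02.
-/
import Literature.NumberTheory.Rogawski1990.DepthZeroKappaTransferTypeTwoRamifiedBlockVertexEigenlines   -- ★ p849349 (A-p12 (g25)) (K4a) 2/3: `eigenline_one_of_block`, `latticeGraphIso_eq_of_eigenline_of_shell`, `eigenline_of_towards_root`; brings 1/3, ★ (K2), ★ (K3)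
import Literature.NumberTheory.Rogawski1990.DepthZeroKappaTransferTypeOneRamifiedHyperbolicLineCounts   -- ★ `childSets_eq_residueTestSets` (F0P3a lineage); brings ★ (V2)
import Literature.NumberTheory.Automorphic.UnitaryLatticeTreeTopVertexLineCountsRamified             -- ★∕filed (this seat): `ncard_children_null_eq_one_of_shape_top`, `ncard_children_quadraticChar_eq_of_shape_top`
import HarnessLib

/-!
# The ramified `κ`-orbital integral, TYPE (2): THE PER-VERTEX TOKEN CENSUS OF A BLOCK LITERAL AT A TOP VERTEX (regime A-even; shape keys `c̄ = 0`, `l̄ ≠ 0`)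
# (Kottwitz 1986 §3; Rogawski 1990 §4.9; Bruhat–Tits 1972 §10)

Topic `NumberTheory/Rogawski1990`; namespace `Literature.NumberTheory.Rogawski1990.TypeOneRamifiedJunction` (the raw head's).  THEOREMS ONLY (no definition, no instance, no
notation, no named fact, no `sorry`); kernel lane `--supports stmt-HodgeConjecture-24833`; datum-free (`K` with `Valued K ℤᵐ⁰`).  Cell `pub/hodgecm-mathlib` (D-0151), crux
H413; road «S3-ram» (count-neutral); (Cnt2′) ROUTE B, chair RULING (16)(b) (regime A-even → p05 (g18) W-side + F0P3-p03 (g16) junction side), A-p12 (g25) 05:07Z: «(K4a) 3/3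
does NOT cover the A-even TOP vertex (`c̄ = res CO = 0`); the top-vertex law is yours to cut in the same currency».  THIS FILE is that corollary: A-p12's ★
`blockVertexCensus_shell` ∕ `_inner` (`DepthZeroKappaTransferTypeTwoRamifiedBlockVertexCensus`) with the shape keys **`c̄ = res CO = 0`, `l̄ = res LO ≠ 0`** — the TOP vertices
of the hyperbolic literal `ι(B₀, 1)` in regime A-even (`N = 2n`, `d₀ = N − 1`: the scalar root datum `b̄₀ = −c̄` vanishes since `d_c > d₀`, and `l̄ ≠ 0` because the centred
`ϖ^N`-ball of `W`-lattices is empty, ★ p05 part X):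

* **`blockVertexCensus_top`** — binders = ★ `blockVertexCensus_shell`'s VERBATIM except `(hc : IsLocalRing.residue 𝒪[K] CO = 0)`, `(hl : IsLocalRing.residue 𝒪[K] LO ≠ 0)`;
  ⊢ **`#E(v) = 0 ∧ #P(v) = q·(q·[χ(c₀l̄) = 1]) ∧ #M(v) = q·(q·[χ(c₀l̄) = −1])`** (ℕ; `c₀ = (res nc₁)⁻¹`, `nc₁ = −c₁`; the three sets = the `hPE ∕ hPP ∕ hPM` per-vertex summands
  of ★ `strataCount_J₀_of_charpoly_block_raw`, VERBATIM as in ★ (K2)).  On the cone the residual value is `l̄·x̄₂²`: the block line `ē₀` (the neighbour `u·N₁`, an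
  eigenline by ★ `eigenline_one_of_block`) is the ONLY null line, so the E-children (null ∧ ¬eigenline = null neighbours ∖ {`u·N₁`}, ★ 2/3 `latticeGraphIso_eq_of_eigenline_of_shell`,
  `c̄`-free) are NONE; the other `q` child lines (one axial, `q − 1` collar: B-p14 (g40) (L2), ★ CollarCensus §3 «`A ≠ 0, C = 0`») all carry the class `[l̄]`, and each has `q`
  off-region grandchildren (★ (K2)) — INCLUDING the axis grandchildren `B′ ⊕ 𝒪e` (`B′` in the next `W`-shell), which are the digit fibre of the axial child.
PROOF = A-p12's shell proof up to the ★ (V2) counts (all `c̄`-free: ★ (K2) `offRegion_tokenSlices_of_lineCounts_of_odd`, ★ `childSets_eq_residueTestSets`, ★ 2/3 §§1–4,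
★ `not_eigenline_of_unit_value`, ★ `eigenline_of_towards_root`), then this seat's ★ `ncard_children_{null_eq_one,quadraticChar_eq}_of_shape_top`.
Consumers: F0P3-p03 (g16) ★ `regionCensus_block_of_kindCounts` (per-kind values `(e,p,m) = (0, q·q, 0) ∕ (0, 0, q·q)` on the kinds `χ(c₀l̄(v)) = ±1`), the A-even cells
`stub_Zhyp_{zero,pm}_even_A` (pen A-p19 (g29)) with this seat's ★ kind multiplicities (`…WSideLatticeCurrencyTopKinds[GL]`: `#R = q+1`, `2·#kind = q+1`).
HONEST LABEL: HC_CM is proved only modulo the 2 remaining named inputs (hLiu418 24832, h413 24833) until rung 0 closes; nothing printed is asserted here (lattice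
bookkeeping over ★ results); «S3-ram» is Literature seeding, count-neutral.

## References
* [Kottwitz1986] R. E. Kottwitz, *Base change for unit elements of Hecke algebras*, Compositio Math. 60 (1986), §3 (counting fixed lattices shell by shell).
* [Rogawski1990] J. D. Rogawski, *Automorphic Representations of Unitary Groups in Three Variables*, Ann. of Math. Stud. 123 (1990), §4.8 Case (a) p. 53, §4.9 pp. 54–56, Prop. 4.9.1 (b).
* [BruhatTits1972] F. Bruhat, J. Tits, *Groupes réductifs sur un corps local I*, Publ. Math. IHÉS 41 (1972), §10 (lattice models of the building).
* [Tits1979] J. Tits, *Reductive groups over local fields*, PSPM 33.1 (1979), §3.5.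
* [Serre1980Trees] J.-P. Serre, *Trees* (1980), Ch. II §1.1.
-/

set_option autoImplicit false

noncomputable section

open scoped Valued WithZero Matrix MatrixGroups
open Polynomial Classical SimpleGraph
open Literature.NumberTheory.Automorphic Literature.NumberTheory.Automorphic.HermitianLattice Literature.NumberTheory.Automorphic.UnitaryLatticeTree
open Literature.NumberTheory.Rogawski1990.HyperbolicJunction Literature.Combinatorics.SimpleGraph.TreeLayers

namespace Literature.NumberTheory.Rogawski1990.TypeOneRamifiedJunction

variable {K : Type*} [Field K] [Valued K ℤᵐ⁰] {σ : K →+* K} {ϖ : K}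

/-! ## The per-vertex census at a TOP vertex -/

set_option maxHeartbeats 3200000 in
/-- **(16)(b) PER-VERTEX VALUES AT A TOP VERTEX** (regime A-even: shape keys `c̄ = res CO = 0`, `l̄ = res LO ≠ 0`).  At a region vertex `v = u·r₀` of `γ ∈ K₀` (`LEV[r₀](ϖ^{d₀})`,
`d₀ ≥ 3` odd) which is BLOCK, ADAPTED and J-SYMMETRIC in the frame `u` (★ (K3)), with keys `c̄ = 0`, `l̄ ≠ 0`:
**`#E(v) = 0`, `#P(v) = q·(q·[χ(c₀l̄) = 1])`, `#M(v) = q·(q·[χ(c₀l̄) = −1])`** (`c₀ = (res nc₁)⁻¹`, `nc₁ = −c₁`; the three sets are the `hPE ∕ hPP ∕ hPM` summands of ★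
`strataCount_J₀_of_charpoly_block_raw` at `v`, VERBATIM as in ★ (K2)) — the residual value on the cone is `l̄·x̄₂²`: one null line (the block neighbour, an eigenline), `q` lines of the
ONE class `[l̄]` (B-p14 (L2); ★ CollarCensus §3 «`A ≠ 0, C = 0`» plus the axial line).  A-p12 (g25)'s ★ `blockVertexCensus_shell` proof up to the counts, then this seat's ★ top counts.
[cite: Kottwitz1986, §3] [cite: Rogawski1990, §4.9 Prop. 4.9.1 (b) p. 55] [cite: BruhatTits1972, §10] -/
theorem blockVertexCensus_top (hσ : ∀ x, σ (σ x) = x) (hvσ : ∀ a, Valued.v (σ a) = Valued.v a) (hσϖ : σ ϖ = -ϖ)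
    (hϖ : Valued.v ϖ = WithZero.exp (-1 : ℤ)) (hres : ∀ x : K, Valued.v x ≤ 1 → Valued.v (σ x - x) < 1) (h2 : Valued.v (2 : K) = 1)
    (hnorm : ∀ u : K, σ u = u → Valued.v (u - 1) < 1 → ∃ z : K, z * σ z = u ∧ Valued.v (z - 1) ≤ Valued.v (u - 1))
    [Fintype 𝓀[K]] [DecidableEq 𝓀[K]] [ValuativeRel K] [(Valued.v : Valuation K ℤᵐ⁰).Compatible]
    (hT : (latticeGraph σ ϖ ((StdForm.antidiagonal 3).over K)).IsTree)
    {γ : unitaryGroupOfForm σ ((StdForm.antidiagonal 3).over K)} (hγ0 : γ ∈ unitaryInt σ ((StdForm.antidiagonal 3).over K))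
    {d₀ : ℕ} (hd3 : 3 ≤ d₀) (hodd : Odd d₀)
    (hnil3 : ∀ (w : {M : Submodule 𝒪[K] (Fin 3 → K) // IsVertex σ ϖ ((StdForm.antidiagonal 3).over K) M}) (e : ℕ), e + 1 ≤ d₀ →
      w.1.map ((Matrix.toLin' (((γ : GL (Fin 3) K) : Matrix (Fin 3) (Fin 3) K) - 1)).restrictScalars 𝒪[K]) ≤ scaleLattice (ϖ ^ e) w.1 →
      w.1.map ((Matrix.toLin' ((((γ : GL (Fin 3) K) : Matrix (Fin 3) (Fin 3) K) - 1) ^ 3)).restrictScalars 𝒪[K]) ≤ scaleLattice (ϖ ^ (3 * e + 1)) w.1)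
    (hroot : (stdLattice K 3).map ((Matrix.toLin' (((γ : GL (Fin 3) K) : Matrix (Fin 3) (Fin 3) K) - 1)).restrictScalars 𝒪[K]) ≤ scaleLattice (ϖ ^ d₀) (stdLattice K 3))
    (c₁ ε : K) (hc₁ : Valued.v c₁ = 1) (hεv : Valued.v ε = 1) (hε : ∀ z : K, Valued.v z ≤ 1 → Valued.v (z ^ 2 - ε) = 1)
    (nc₁ : 𝒪[K]) (hnc₁ : (nc₁ : K) = -c₁)
    (u : unitaryGroupOfForm σ ((StdForm.antidiagonal 3).over K)) {v : {M : Submodule 𝒪[K] (Fin 3 → K) // IsVertex σ ϖ ((StdForm.antidiagonal 3).over K) M}} (hvu : v = latticeGraphIso σ ϖ ((StdForm.antidiagonal 3).over K) u ⟨stdLattice K 3, 0, isSelfDualLattice_stdLattice_three_of_v hϖ⟩)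
    (hv : IsSelfDualLattice σ ϖ ((StdForm.antidiagonal 3).over K) v.1) (hfix : latticeGraphIso σ ϖ ((StdForm.antidiagonal 3).over K) γ v = v)
    (hvR : v.1.map ((Matrix.toLin' (((γ : GL (Fin 3) K) : Matrix (Fin 3) (Fin 3) K) - 1)).restrictScalars 𝒪[K]) ≤ scaleLattice (ϖ ^ d₀) v.1)
    (g₁ : GL (Fin 2) K) (u' : GL (Fin 1) K) (hγu : ((u⁻¹ * γ * u : unitaryGroupOfForm σ ((StdForm.antidiagonal 3).over K)) : GL (Fin 3) K) = endoGL (g₁, u'))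
    (hadapt : Valued.v ((ϖ ^ d₀)⁻¹ * (g₁ : Matrix (Fin 2) (Fin 2) K) 1 0) < 1)
    (hsym : Valued.v ((ϖ ^ d₀)⁻¹ * ((((g₁ : Matrix (Fin 2) (Fin 2) K) - 1) 0 0) - (((g₁ : Matrix (Fin 2) (Fin 2) K) - 1) 1 1))) < 1)
    (CO : 𝒪[K]) (hCO : (CO : K) = (ϖ ^ d₀)⁻¹ * ((u' : Matrix (Fin 1) (Fin 1) K) 0 0 - (g₁ : Matrix (Fin 2) (Fin 2) K) 0 0)) (hc : IsLocalRing.residue 𝒪[K] CO = 0)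
    (LO : 𝒪[K]) (hLO : (LO : K) = (ϖ ^ d₀)⁻¹ * (g₁ : Matrix (Fin 2) (Fin 2) K) 0 1) (hl : IsLocalRing.residue 𝒪[K] LO ≠ 0) :
    ({w | w ∈ {w | ∃ c, ((latticeGraph σ ϖ ((StdForm.antidiagonal 3).over K)).Adj v c ∧ (latticeGraph σ ϖ ((StdForm.antidiagonal 3).over K)).dist ⟨stdLattice K 3, 0, isSelfDualLattice_stdLattice_three_of_v hϖ⟩ c = (latticeGraph σ ϖ ((StdForm.antidiagonal 3).over K)).dist ⟨stdLattice K 3, 0, isSelfDualLattice_stdLattice_three_of_v hϖ⟩ v + 1 ∧ latticeGraphIso σ ϖ ((StdForm.antidiagonal 3).over K) γ c = c) ∧ ((latticeGraph σ ϖ ((StdForm.antidiagonal 3).over K)).Adj c w ∧ (latticeGraph σ ϖ ((StdForm.antidiagonal 3).over K)).dist ⟨stdLattice K 3, 0, isSelfDualLattice_stdLattice_three_of_v hϖ⟩ w = (latticeGraph σ ϖ ((StdForm.antidiagonal 3).over K)).dist ⟨stdLattice K 3, 0, isSelfDualLattice_stdLattice_three_of_v hϖ⟩ c + 1 ∧ latticeGraphIso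 σ ϖ ((StdForm.antidiagonal 3).over K) γ w = w)} ∧ (¬ w.1.map ((Matrix.toLin' (((γ : GL (Fin 3) K) : Matrix (Fin 3) (Fin 3) K) - 1)).restrictScalars 𝒪[K]) ≤ scaleLattice (ϖ ^ d₀) w.1 ∧ (w.1.map ((Matrix.toLin' (((γ : GL (Fin 3) K) : Matrix (Fin 3) (Fin 3) K) - 1)).restrictScalars 𝒪[K]) ≤ scaleLattice (ϖ ^ (d₀ - 1)) w.1 ∧ ¬ w.1.map ((Matrix.toLin' (((γ : GL (Fin 3) K) : Matrix (Fin 3) (Fin 3) K) - 1)).restrictScalars 𝒪[K]) ≤ scaleLattice (ϖ ^ d₀) w.1))}).ncard = 0 ∧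
    ({w | w ∈ {w | ∃ c, ((latticeGraph σ ϖ ((StdForm.antidiagonal 3).over K)).Adj v c ∧ (latticeGraph σ ϖ ((StdForm.antidiagonal 3).over K)).dist ⟨stdLattice K 3, 0, isSelfDualLattice_stdLattice_three_of_v hϖ⟩ c = (latticeGraph σ ϖ ((StdForm.antidiagonal 3).over K)).dist ⟨stdLattice K 3, 0, isSelfDualLattice_stdLattice_three_of_v hϖ⟩ v + 1 ∧ latticeGraphIso σ ϖ ((StdForm.antidiagonal 3).over K) γ c = c) ∧ ((latticeGraph σ ϖ ((StdForm.antidiagonal 3).over K)).Adj c w ∧ (latticeGraph σ ϖ ((StdForm.antidiagonal 3).over K)).dist ⟨stdLattice K 3, 0, isSelfDualLattice_stdLattice_three_of_v hϖ⟩ w = (latticeGraph σ ϖ ((StdForm.antidiagonal 3).over K)).dist ⟨stdLattice K 3, 0, isSelfDualLattice_stdLattice_three_of_v hϖ⟩ c + 1 ∧ latticeGraphIso σ ϖ ((StdForm.antidiagonal 3).over K) γ w = w)} ∧ (¬ w.1.map ((Matrix.toLin' (((γ : GL (Fin 3) K) : Matrix (Fin 3) (Fin 3) K) - 1)).restrictScalars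 𝒪[K]) ≤ scaleLattice (ϖ ^ d₀) w.1 ∧ (w.1.map ((Matrix.toLin' (((γ : GL (Fin 3) K) : Matrix (Fin 3) (Fin 3) K) - 1)).restrictScalars 𝒪[K]) ≤ scaleLattice (ϖ ^ (d₀ - 2)) w.1 ∧ ¬ w.1.map ((Matrix.toLin' (((γ : GL (Fin 3) K) : Matrix (Fin 3) (Fin 3) K) - 1)).restrictScalars 𝒪[K]) ≤ scaleLattice (ϖ ^ (d₀ - 1)) w.1) ∧ ∃ y ∈ w.1, ∃ a : K, Valued.v a = 1 ∧ Valued.v ((ϖ ^ (d₀ - 2))⁻¹ * pairing σ ((StdForm.antidiagonal 3).over K) y ((((γ : GL (Fin 3) K) : Matrix (Fin 3) (Fin 3) K) - 1) *ᵥ y) - (c₁) * a ^ 2) < 1)}).ncard = Fintype.card 𝓀[K] * (Fintype.card 𝓀[K] * (if quadraticChar 𝓀[K] ((IsLocalRing.residue 𝒪[K] nc₁)⁻¹ * IsLocalRing.residue 𝒪[K] LO) = 1 then 1 else 0)) ∧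
    ({w | w ∈ {w | ∃ c, ((latticeGraph σ ϖ ((StdForm.antidiagonal 3).over K)).Adj v c ∧ (latticeGraph σ ϖ ((StdForm.antidiagonal 3).over K)).dist ⟨stdLattice K 3, 0, isSelfDualLattice_stdLattice_three_of_v hϖ⟩ c = (latticeGraph σ ϖ ((StdForm.antidiagonal 3).over K)).dist ⟨stdLattice K 3, 0, isSelfDualLattice_stdLattice_three_of_v hϖ⟩ v + 1 ∧ latticeGraphIso σ ϖ ((StdForm.antidiagonal 3).over K) γ c = c) ∧ ((latticeGraph σ ϖ ((StdForm.antidiagonal 3).over K)).Adj c w ∧ (latticeGraph σ ϖ ((StdForm.antidiagonal 3).over K)).dist ⟨stdLattice K 3, 0, isSelfDualLattice_stdLattice_three_of_v hϖ⟩ w = (latticeGraph σ ϖ ((StdForm.antidiagonal 3).over K)).dist ⟨stdLattice K 3, 0, isSelfDualLattice_stdLattice_three_of_v hϖ⟩ c + 1 ∧ latticeGraphIso σ ϖ ((StdForm.antidiagonal 3).over K) γ w = w)} ∧ (¬ w.1.map ((Matrix.toLin' (((γ : GL (Fin 3) K) : Matrix (Fin 3) (Fin 3) K) - 1)).restrictScalars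 𝒪[K]) ≤ scaleLattice (ϖ ^ d₀) w.1 ∧ (w.1.map ((Matrix.toLin' (((γ : GL (Fin 3) K) : Matrix (Fin 3) (Fin 3) K) - 1)).restrictScalars 𝒪[K]) ≤ scaleLattice (ϖ ^ (d₀ - 2)) w.1 ∧ ¬ w.1.map ((Matrix.toLin' (((γ : GL (Fin 3) K) : Matrix (Fin 3) (Fin 3) K) - 1)).restrictScalars 𝒪[K]) ≤ scaleLattice (ϖ ^ (d₀ - 1)) w.1) ∧ ¬ (∃ y ∈ w.1, ∃ a : K, Valued.v a = 1 ∧ Valued.v ((ϖ ^ (d₀ - 2))⁻¹ * pairing σ ((StdForm.antidiagonal 3).over K) y ((((γ : GL (Fin 3) K) : Matrix (Fin 3) (Fin 3) K) - 1) *ᵥ y) - (c₁) * a ^ 2) < 1))}).ncard = Fintype.card 𝓀[K] * (Fintype.card 𝓀[K] * (if quadraticChar 𝓀[K] ((IsLocalRing.residue 𝒪[K] nc₁)⁻¹ * IsLocalRing.residue 𝒪[K] LO) = -1 then 1 else 0)) := by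
  have hϖ0 : ϖ ≠ 0 := fun h0 => by rw [h0, map_zero] at hϖ; exact WithZero.coe_ne_zero hϖ.symm
  have hvϖ0 : Valued.v ϖ ≠ 0 := (Valuation.ne_zero_iff _).2 hϖ0
  have hϖ1 : Valued.v ϖ ≤ 1 := by rw [hϖ, ← WithZero.exp_zero]; exact WithZero.exp_le_exp.2 (by norm_num)
  haveI : Fact (Fintype.card 𝓀[K] ≠ 0) := ⟨Fintype.card_ne_zero⟩
  -- the level of the vertex on the frame
  have hdeep : ∀ i j, Valued.v (((((u⁻¹ * γ * u : unitaryGroupOfForm σ ((StdForm.antidiagonal 3).over K)) : GL (Fin 3) K) : Matrix (Fin 3) (Fin 3) K) - 1) i j) ≤ Valued.v ϖ ^ d₀ := by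
    have h := (forall_v_conj_sub_one_le_iff_map_sub_one_le_scaleLattice γ u (pow_ne_zero d₀ hϖ0)).1 (by rw [hvu] at hvR; exact hvR)
    intro i j; rw [← map_pow]; exact h i j
  have hadapt' : Valued.v ((g₁ : Matrix (Fin 2) (Fin 2) K) 1 0) ≤ Valued.v ϖ ^ (d₀ + 1) := (v_inv_pow_mul_lt_one_iff hϖ d₀ _).1 hadapt
  have hsym' : Valued.v (((g₁ : Matrix (Fin 2) (Fin 2) K) - 1) 0 0 - ((g₁ : Matrix (Fin 2) (Fin 2) K) - 1) 1 1) ≤ Valued.v ϖ ^ (d₀ + 1) := (v_inv_pow_mul_lt_one_iff hϖ d₀ _).1 hsym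
  -- the integral leading term `Y₀ = ϖ^{−d₀}·M` and the shape keys (★ (K3))
  have hint : ∀ a b, (ϖ ^ d₀)⁻¹ * ((((u⁻¹ * γ * u : unitaryGroupOfForm σ ((StdForm.antidiagonal 3).over K)) : GL (Fin 3) K) : Matrix (Fin 3) (Fin 3) K) - 1) a b ∈ 𝒪[K] := by
    intro a b
    rw [Valuation.mem_integer_iff, map_mul, map_inv₀, map_pow]
    calc (Valued.v ϖ ^ d₀)⁻¹ * Valued.v (((((u⁻¹ * γ * u : unitaryGroupOfForm σ ((StdForm.antidiagonal 3).over K)) : GL (Fin 3) K) : Matrix (Fin 3) (Fin 3) K) - 1) a b) ≤ (Valued.v ϖ ^ d₀)⁻¹ * Valued.v ϖ ^ d₀ := mul_le_mul' le_rfl (hdeep a b)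
      _ = 1 := inv_mul_cancel₀ (pow_ne_zero _ hvϖ0)
  obtain ⟨Y₀, hY₀⟩ : ∃ Y₀ : Matrix (Fin 3) (Fin 3) 𝒪[K], ∀ a b, ((Y₀ a b : 𝒪[K]) : K) = (ϖ ^ d₀)⁻¹ * ((((u⁻¹ * γ * u : unitaryGroupOfForm σ ((StdForm.antidiagonal 3).over K)) : GL (Fin 3) K) : Matrix (Fin 3) (Fin 3) K) - 1) a b :=
    ⟨Matrix.of fun a b => ⟨_, hint a b⟩, fun a b => rfl⟩
  obtain ⟨hshape, -, hLOiff⟩ := blockVertexShape_keys h2 γ u g₁ u' hγu Y₀ hY₀ hadapt hsym CO hCO LO hLO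
  -- the class constants in `𝒪`
  have hnc₁v : Valued.v (nc₁ : K) = 1 := by rw [hnc₁, Valuation.map_neg, hc₁]
  have hnc₁0 : IsLocalRing.residue 𝒪[K] nc₁ ≠ 0 := by
    rw [Ne, residue_eq_zero_iff_v_lt_one, hnc₁v]; exact lt_irrefl 1
  have hc₀ : (IsLocalRing.residue 𝒪[K] nc₁)⁻¹ ≠ 0 := inv_ne_zero hnc₁0
  obtain ⟨εO, hεO⟩ : ∃ εO : 𝒪[K], (εO : K) = ε := ⟨⟨ε, (Valuation.mem_integer_iff _ _).2 hεv.le⟩, rfl⟩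
  obtain ⟨hNBnull, hNBP, hNBM⟩ := childSets_eq_residueTestSets hvσ hσϖ hϖ hres c₁ ε hε u hvu Y₀ hY₀ nc₁ hnc₁ hnc₁v εO hεO
  -- children of `v`: a neighbour whose line is not an eigenline is not the parent (§3)
  have hchild : ∀ (c : {M : Submodule 𝒪[K] (Fin 3 → K) // IsVertex σ ϖ ((StdForm.antidiagonal 3).over K) M}) (κ : unitaryGroupOfForm σ ((StdForm.antidiagonal 3).over K)), (latticeGraph σ ϖ ((StdForm.antidiagonal 3).over K)).Adj v c → κ ∈ unitaryInt σ ((StdForm.antidiagonal 3).over K) →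
      c = latticeGraphIso σ ϖ ((StdForm.antidiagonal 3).over K) (u * κ) ⟨latt (Matrix.diagonal ![(1 : K), 1, ϖ]), 2, isVertexLattice_two_N₁_of_neg hσϖ hϖ⟩ → ¬ (Valued.v (((((((u * κ : unitaryGroupOfForm σ ((StdForm.antidiagonal 3).over K)) : GL (Fin 3) K))⁻¹ : GL (Fin 3) K) : Matrix (Fin 3) (Fin 3) K) * (((γ : GL (Fin 3) K) : Matrix (Fin 3) (Fin 3) K) - 1) * (((u * κ : unitaryGroupOfForm σ ((StdForm.antidiagonal 3).over K)) : GL (Fin 3) K) : Matrix (Fin 3) (Fin 3) K)) 1 0) ≤ Valued.v ϖ ^ (d₀ + 1) ∧ Valued.v (((((((u * κ : unitaryGroupOfForm σ ((StdForm.antidiagonal 3).over K)) : GL (Fin 3) K))⁻¹ : GL (Fin 3) K) : Matrix (Fin 3) (Fin 3) K) * (((γ : GL (Fin 3) K) : Matrix (Fin 3) (Fin 3) K) - 1) * (((u * κ : unitaryGroupOfForm σ ((StdForm.antidiagonal 3).over K)) : GL (Fin 3) K) : Matrix (Fin 3) (Fin 3) K)) 2 0) ≤ Valued.v ϖ ^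 (d₀ + 1)) →
      (latticeGraph σ ϖ ((StdForm.antidiagonal 3).over K)).dist ⟨stdLattice K 3, 0, isSelfDualLattice_stdLattice_three_of_v hϖ⟩ c = (latticeGraph σ ϖ ((StdForm.antidiagonal 3).over K)).dist ⟨stdLattice K 3, 0, isSelfDualLattice_stdLattice_three_of_v hϖ⟩ v + 1 := by
    intro c κ hadj hκ hc hnE
    by_cases hvr : v = ⟨stdLattice K 3, 0, isSelfDualLattice_stdLattice_three_of_v hϖ⟩
    · rw [hvr, SimpleGraph.dist_self, zero_add]
      rw [hvr] at hadj
      exact SimpleGraph.dist_eq_one_iff_adj.2 hadj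
    · obtain ⟨P, hP1, hP5, -, -⟩ := exists_rooted_parent hT (⟨stdLattice K 3, 0, isSelfDualLattice_stdLattice_three_of_v hϖ⟩ : {M : Submodule 𝒪[K] (Fin 3 → K) // IsVertex σ ϖ ((StdForm.antidiagonal 3).over K) M})
      by_cases hcP : c = P v
      · exfalso
        refine hnE (eigenline_of_towards_root hσ hvσ hσϖ hϖ hres h2 hnorm hT hγ0 hodd hroot u hvu hv hvr hfix hvR hκ ?_)
        rw [← hc, hcP]; exact (hP1 v hvr).2
      · exact (hP5 v c hvr hadj hcP).1
  -- the neighbour `(uκ)·N₁` IS a neighbour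
  have hadjκ : ∀ κ : unitaryGroupOfForm σ ((StdForm.antidiagonal 3).over K), κ ∈ unitaryInt σ ((StdForm.antidiagonal 3).over K) → (latticeGraph σ ϖ ((StdForm.antidiagonal 3).over K)).Adj v (latticeGraphIso σ ϖ ((StdForm.antidiagonal 3).over K) (u * κ) ⟨latt (Matrix.diagonal ![(1 : K), 1, ϖ]), 2, isVertexLattice_two_N₁_of_neg hσϖ hϖ⟩) := by
    intro κ hκ
    have h := (mem_neighborSet_latticeGraphIso_root_iff hσ hvσ hσϖ hϖ h2 u (latticeGraphIso σ ϖ ((StdForm.antidiagonal 3).over K) (u * κ) ⟨latt (Matrix.diagonal ![(1 : K), 1, ϖ]), 2, isVertexLattice_two_N₁_of_neg hσϖ hϖ⟩)).2 ⟨κ, hκ, rfl⟩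
    rw [SimpleGraph.mem_neighborSet] at h
    rw [hvu]; exact h
  -- the class children are ALL class neighbours (a unit value is never an eigenline, §2)
  have hnc₁u : Valued.v (-c₁) = 1 := by rw [Valuation.map_neg, hc₁]
  have hnc₁εu : Valued.v (-(c₁ * ε)) = 1 := by rw [Valuation.map_neg, map_mul, hc₁, hεv, mul_one]
  have hP : {c : {M : Submodule 𝒪[K] (Fin 3 → K) // IsVertex σ ϖ ((StdForm.antidiagonal 3).over K) M} | (latticeGraph σ ϖ ((StdForm.antidiagonal 3).over K)).Adj v c ∧ (latticeGraph σ ϖ ((StdForm.antidiagonal 3).over K)).dist ⟨stdLattice K 3, 0, isSelfDualLattice_stdLattice_three_of_v hϖ⟩ c = (latticeGraph σ ϖ ((StdForm.antidiagonal 3).over K)).dist ⟨stdLattice K 3, 0, isSelfDualLattice_stdLattice_three_of_v hϖ⟩ v + 1 ∧ ∃ κ : unitaryGroupOfForm σ ((StdForm.antidiagonal 3).over K), κ ∈ unitaryInt σ ((StdForm.antidiagonal 3).over K) ∧ c = latticeGraphIso σ ϖ ((StdForm.antidiagonal 3).over K) (u * κ) ⟨latt (Matrix.diagonal ![(1 :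 K), 1, ϖ]), 2, isVertexLattice_two_N₁_of_neg hσϖ hϖ⟩ ∧ (¬ (Valued.v (((((((u * κ : unitaryGroupOfForm σ ((StdForm.antidiagonal 3).over K)) : GL (Fin 3) K))⁻¹ : GL (Fin 3) K) : Matrix (Fin 3) (Fin 3) K) * (((γ : GL (Fin 3) K) : Matrix (Fin 3) (Fin 3) K) - 1) * (((u * κ : unitaryGroupOfForm σ ((StdForm.antidiagonal 3).over K)) : GL (Fin 3) K) : Matrix (Fin 3) (Fin 3) K)) 1 0) ≤ Valued.v ϖ ^ (d₀ + 1) ∧ Valued.v (((((((u * κ : unitaryGroupOfForm σ ((StdForm.antidiagonal 3).over K)) : GL (Fin 3) K))⁻¹ : GL (Fin 3) K) : Matrix (Fin 3) (Fin 3) K) * (((γ : GL (Fin 3) K) : Matrix (Fin 3) (Fin 3) K) - 1) * (((u * κ : unitaryGroupOfForm σ ((StdForm.antidiagonal 3).over K)) : GL (Fin 3) K) : Matrix (Fin 3) (Fin 3) K)) 2 0) ≤ Valued.v ϖ ^ (d₀ + 1)) ∧ ∃ a : K, Valued.v a = 1 ∧ Valued.v (((ϖ ^ d₀)⁻¹ *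 pairing σ ((StdForm.antidiagonal 3).over K) (((κ : GL (Fin 3) K) : Matrix (Fin 3) (Fin 3) K) *ᵥ Pi.single 0 1) (((((u⁻¹ * γ * u : unitaryGroupOfForm σ ((StdForm.antidiagonal 3).over K)) : GL (Fin 3) K) : Matrix (Fin 3) (Fin 3) K) - 1) *ᵥ (((κ : GL (Fin 3) K) : Matrix (Fin 3) (Fin 3) K) *ᵥ Pi.single 0 1))) - (-c₁) * a ^ 2) < 1)} =
      {c : {M : Submodule 𝒪[K] (Fin 3 → K) // IsVertex σ ϖ ((StdForm.antidiagonal 3).over K) M} | (latticeGraph σ ϖ ((StdForm.antidiagonal 3).over K)).Adj v c ∧ ∃ κ : unitaryGroupOfForm σ ((StdForm.antidiagonal 3).over K), κ ∈ unitaryInt σ ((StdForm.antidiagonal 3).over K) ∧ c = latticeGraphIso σ ϖ ((StdForm.antidiagonal 3).over K) (u * κ) ⟨latt (Matrix.diagonal ![(1 : K), 1, ϖ]), 2, isVertexLattice_two_N₁_of_neg hσϖ hϖ⟩ ∧ (∃ a : K, Valued.v a = 1 ∧ Valued.v (((ϖ ^ d₀)⁻¹ * pairing σ ((StdForm.antidiagonal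 3).over K) (((κ : GL (Fin 3) K) : Matrix (Fin 3) (Fin 3) K) *ᵥ Pi.single 0 1) (((((u⁻¹ * γ * u : unitaryGroupOfForm σ ((StdForm.antidiagonal 3).over K)) : GL (Fin 3) K) : Matrix (Fin 3) (Fin 3) K) - 1) *ᵥ (((κ : GL (Fin 3) K) : Matrix (Fin 3) (Fin 3) K) *ᵥ Pi.single 0 1))) - (-c₁) * a ^ 2) < 1)} := by
    ext c
    simp only [Set.mem_setOf_eq]
    constructor
    · rintro ⟨hadj, -, κ, hκ, hc, -, hcls⟩
      exact ⟨hadj, κ, hκ, hc, hcls⟩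
    · rintro ⟨hadj, κ, hκ, hc, hcls⟩
      have hnE := not_eigenline_of_unit_value hϖ u γ κ d₀ hnc₁u hcls
      exact ⟨hadj, hchild c κ hadj hκ hc hnE, κ, hκ, hc, hnE, hcls⟩
  have hM : {c : {M : Submodule 𝒪[K] (Fin 3 → K) // IsVertex σ ϖ ((StdForm.antidiagonal 3).over K) M} | (latticeGraph σ ϖ ((StdForm.antidiagonal 3).over K)).Adj v c ∧ (latticeGraph σ ϖ ((StdForm.antidiagonal 3).over K)).dist ⟨stdLattice K 3, 0, isSelfDualLattice_stdLattice_three_of_v hϖ⟩ c = (latticeGraph σ ϖ ((StdForm.antidiagonal 3).over K)).dist ⟨stdLattice K 3, 0, isSelfDualLattice_stdLattice_three_of_v hϖ⟩ v + 1 ∧ ∃ κ : unitaryGroupOfForm σ ((StdForm.antidiagonal 3).over K), κ ∈ unitaryInt σ ((StdForm.antidiagonal 3).over K) ∧ c = latticeGraphIso σ ϖ ((StdForm.antidiagonal 3).over K) (u * κ) ⟨latt (Matrix.diagonal ![(1 : K), 1, ϖ]), 2, isVertexLattice_two_N₁_of_neg hσϖ hϖ⟩ ∧ (¬ (Valued.v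 (((((((u * κ : unitaryGroupOfForm σ ((StdForm.antidiagonal 3).over K)) : GL (Fin 3) K))⁻¹ : GL (Fin 3) K) : Matrix (Fin 3) (Fin 3) K) * (((γ : GL (Fin 3) K) : Matrix (Fin 3) (Fin 3) K) - 1) * (((u * κ : unitaryGroupOfForm σ ((StdForm.antidiagonal 3).over K)) : GL (Fin 3) K) : Matrix (Fin 3) (Fin 3) K)) 1 0) ≤ Valued.v ϖ ^ (d₀ + 1) ∧ Valued.v (((((((u * κ : unitaryGroupOfForm σ ((StdForm.antidiagonal 3).over K)) : GL (Fin 3) K))⁻¹ : GL (Fin 3) K) : Matrix (Fin 3) (Fin 3) K) * (((γ : GL (Fin 3) K) : Matrix (Fin 3) (Fin 3) K) - 1) * (((u * κ : unitaryGroupOfForm σ ((StdForm.antidiagonal 3).over K)) : GL (Fin 3) K) : Matrix (Fin 3) (Fin 3) K)) 2 0) ≤ Valued.v ϖ ^ (d₀ + 1)) ∧ ∃ a : K, Valued.v a = 1 ∧ Valued.v (((ϖ ^ d₀)⁻¹ * pairing σ ((StdForm.antidiagonal 3).over K) (((κ : GL (Fin 3) K) : Matrix (Fin 3) (Fin 3)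 K) *ᵥ Pi.single 0 1) (((((u⁻¹ * γ * u : unitaryGroupOfForm σ ((StdForm.antidiagonal 3).over K)) : GL (Fin 3) K) : Matrix (Fin 3) (Fin 3) K) - 1) *ᵥ (((κ : GL (Fin 3) K) : Matrix (Fin 3) (Fin 3) K) *ᵥ Pi.single 0 1))) - (-(c₁ * ε)) * a ^ 2) < 1)} =
      {c : {M : Submodule 𝒪[K] (Fin 3 → K) // IsVertex σ ϖ ((StdForm.antidiagonal 3).over K) M} | (latticeGraph σ ϖ ((StdForm.antidiagonal 3).over K)).Adj v c ∧ ∃ κ : unitaryGroupOfForm σ ((StdForm.antidiagonal 3).over K), κ ∈ unitaryInt σ ((StdForm.antidiagonal 3).over K) ∧ c = latticeGraphIso σ ϖ ((StdForm.antidiagonal 3).over K) (u * κ) ⟨latt (Matrix.diagonal ![(1 : K), 1, ϖ]), 2, isVertexLattice_two_N₁_of_neg hσϖ hϖ⟩ ∧ (∃ a : K, Valued.v a = 1 ∧ Valued.v (((ϖ ^ d₀)⁻¹ * pairing σ ((StdForm.antidiagonal 3).over K) (((κ : GL (Fin 3) K) : Matrix (Fin 3) (Fin 3) K) *ᵥ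 Pi.single 0 1) (((((u⁻¹ * γ * u : unitaryGroupOfForm σ ((StdForm.antidiagonal 3).over K)) : GL (Fin 3) K) : Matrix (Fin 3) (Fin 3) K) - 1) *ᵥ (((κ : GL (Fin 3) K) : Matrix (Fin 3) (Fin 3) K) *ᵥ Pi.single 0 1))) - (-(c₁ * ε)) * a ^ 2) < 1)} := by
    ext c
    simp only [Set.mem_setOf_eq]
    constructor
    · rintro ⟨hadj, -, κ, hκ, hc, -, hcls⟩
      exact ⟨hadj, κ, hκ, hc, hcls⟩
    · rintro ⟨hadj, κ, hκ, hc, hcls⟩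
      have hnE := not_eigenline_of_unit_value hϖ u γ κ d₀ hnc₁εu hcls
      exact ⟨hadj, hchild c κ hadj hκ hc hnE, κ, hκ, hc, hnE, hcls⟩
  -- ★ (K2): the token counts are `q ×` the child counts
  obtain ⟨kE, kP, kM⟩ := offRegion_tokenSlices_of_lineCounts_of_odd hσ hvσ hσϖ hϖ hres h2 hT hγ0 hd3 hodd hnil3 c₁ ε hc₁ hεv hε u hvu hv hfix hvR _ _ _ rfl rfl rfl
  have hq : Nat.card 𝓀[K] = Fintype.card 𝓀[K] := Nat.card_eq_fintype_card
  have hl' : ¬ Valued.v ((g₁ : Matrix (Fin 2) (Fin 2) K) 0 1) ≤ Valued.v ϖ ^ (d₀ + 1) := fun h => hl (hLOiff.2 ((v_inv_pow_mul_lt_one_iff hϖ d₀ _).2 h))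
  -- the block neighbour `u·N₁` is a null neighbour
  have hone_mem : (latticeGraphIso σ ϖ ((StdForm.antidiagonal 3).over K) (u * 1) ⟨latt (Matrix.diagonal ![(1 : K), 1, ϖ]), 2, isVertexLattice_two_N₁_of_neg hσϖ hϖ⟩) ∈ {c : {M : Submodule 𝒪[K] (Fin 3 → K) // IsVertex σ ϖ ((StdForm.antidiagonal 3).over K) M} | (latticeGraph σ ϖ ((StdForm.antidiagonal 3).over K)).Adj v c ∧ ∃ κ : unitaryGroupOfForm σ ((StdForm.antidiagonal 3).over K), κ ∈ unitaryInt σ ((StdForm.antidiagonal 3).over K) ∧ c = latticeGraphIso σ ϖ ((StdForm.antidiagonal 3).over K) (u * κ) ⟨latt (Matrix.diagonal ![(1 : K), 1, ϖ]), 2, isVertexLattice_two_N₁_of_neg hσϖ hϖ⟩ ∧ Valued.v ((ϖ ^ d₀)⁻¹ * pairing σ ((StdForm.antidiagonal 3).over K) (((κ : GL (Fin 3) K) : Matrix (Fin 3) (Fin 3) K) *ᵥ Pi.single 0 1) (((((u⁻¹ * γ * u : unitaryGroupOfForm σ ((StdForm.antidiagonal 3).over K)) : GL (Fin 3) K) :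 Matrix (Fin 3) (Fin 3) K) - 1) *ᵥ (((κ : GL (Fin 3) K) : Matrix (Fin 3) (Fin 3) K) *ᵥ Pi.single 0 1))) < 1} := by
    refine ⟨hadjκ 1 (one_mem _), 1, one_mem _, rfl, ?_⟩
    rw [pairing_coe_mulVec_single_eq_inv_mul_mul_apply (1 : unitaryGroupOfForm σ ((StdForm.antidiagonal 3).over K)), Subgroup.coe_one, inv_one, Units.val_one, Matrix.one_mul, Matrix.mul_one, hγu,
      coe_endoGL_sub_one_eq_endoShape]
    simpa [Matrix.sub_apply, Matrix.one_apply_ne] using hadapt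
  -- the null-and-not-eigenline children are the null neighbours minus `u·N₁` (§5, §1, §4)
  have hE : {c : {M : Submodule 𝒪[K] (Fin 3 → K) // IsVertex σ ϖ ((StdForm.antidiagonal 3).over K) M} | (latticeGraph σ ϖ ((StdForm.antidiagonal 3).over K)).Adj v c ∧ (latticeGraph σ ϖ ((StdForm.antidiagonal 3).over K)).dist ⟨stdLattice K 3, 0, isSelfDualLattice_stdLattice_three_of_v hϖ⟩ c = (latticeGraph σ ϖ ((StdForm.antidiagonal 3).over K)).dist ⟨stdLattice K 3, 0, isSelfDualLattice_stdLattice_three_of_v hϖ⟩ v + 1 ∧ ∃ κ : unitaryGroupOfForm σ ((StdForm.antidiagonal 3).over K), κ ∈ unitaryInt σ ((StdForm.antidiagonal 3).over K) ∧ c = latticeGraphIso σ ϖ ((StdForm.antidiagonal 3).over K) (u * κ) ⟨latt (Matrix.diagonal ![(1 : K), 1, ϖ]), 2, isVertexLattice_two_N₁_of_neg hσϖ hϖ⟩ ∧ (¬ (Valued.v (((((((u * κ : unitaryGroupOfForm σ ((StdForm.antidiagonal 3).over K)) : GL (Fin 3) K))⁻¹ : GL (Fin 3) K) : Matrix (Fin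 3) (Fin 3) K) * (((γ : GL (Fin 3) K) : Matrix (Fin 3) (Fin 3) K) - 1) * (((u * κ : unitaryGroupOfForm σ ((StdForm.antidiagonal 3).over K)) : GL (Fin 3) K) : Matrix (Fin 3) (Fin 3) K)) 1 0) ≤ Valued.v ϖ ^ (d₀ + 1) ∧ Valued.v (((((((u * κ : unitaryGroupOfForm σ ((StdForm.antidiagonal 3).over K)) : GL (Fin 3) K))⁻¹ : GL (Fin 3) K) : Matrix (Fin 3) (Fin 3) K) * (((γ : GL (Fin 3) K) : Matrix (Fin 3) (Fin 3) K) - 1) * (((u * κ : unitaryGroupOfForm σ ((StdForm.antidiagonal 3).over K)) : GL (Fin 3) K) : Matrix (Fin 3) (Fin 3) K)) 2 0) ≤ Valued.v ϖ ^ (d₀ + 1)) ∧ Valued.v ((ϖ ^ d₀)⁻¹ * pairing σ ((StdForm.antidiagonal 3).over K) (((κ : GL (Fin 3) K) : Matrix (Fin 3) (Fin 3) K) *ᵥ Pi.single 0 1) (((((u⁻¹ * γ * u : unitaryGroupOfForm σ ((StdForm.antidiagonal 3).over K)) : GL (Fin 3) K) : Matrix (Fin 3) (Fin 3) K) - 1)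 *ᵥ (((κ : GL (Fin 3) K) : Matrix (Fin 3) (Fin 3) K) *ᵥ Pi.single 0 1))) < 1)} =
      {c : {M : Submodule 𝒪[K] (Fin 3 → K) // IsVertex σ ϖ ((StdForm.antidiagonal 3).over K) M} | (latticeGraph σ ϖ ((StdForm.antidiagonal 3).over K)).Adj v c ∧ ∃ κ : unitaryGroupOfForm σ ((StdForm.antidiagonal 3).over K), κ ∈ unitaryInt σ ((StdForm.antidiagonal 3).over K) ∧ c = latticeGraphIso σ ϖ ((StdForm.antidiagonal 3).over K) (u * κ) ⟨latt (Matrix.diagonal ![(1 : K), 1, ϖ]), 2, isVertexLattice_two_N₁_of_neg hσϖ hϖ⟩ ∧ Valued.v ((ϖ ^ d₀)⁻¹ * pairing σ ((StdForm.antidiagonal 3).over K) (((κ : GL (Fin 3) K) : Matrix (Fin 3) (Fin 3) K) *ᵥ Pi.single 0 1) (((((u⁻¹ * γ * u : unitaryGroupOfForm σ ((StdForm.antidiagonal 3).over K)) : GL (Fin 3) K) : Matrix (Fin 3) (Fin 3) K) - 1) *ᵥ (((κ : GL (Fin 3) K) : Matrix (Fin 3) (Fin 3) K) *ᵥ Pi.single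 0 1))) < 1} \ {(latticeGraphIso σ ϖ ((StdForm.antidiagonal 3).over K) (u * 1) ⟨latt (Matrix.diagonal ![(1 : K), 1, ϖ]), 2, isVertexLattice_two_N₁_of_neg hσϖ hϖ⟩)} := by
    ext c
    simp only [Set.mem_setOf_eq, Set.mem_sdiff, Set.mem_singleton_iff]
    constructor
    · rintro ⟨hadj, -, κ, hκ, hc, hnE, hnull⟩
      refine ⟨⟨hadj, κ, hκ, hc, hnull⟩, fun hc1 => hnE ?_⟩
      -- `c = u·N₁ = (uκ)·N₁`: the eigenline clause passes from `1` to `κ` (§1 rep-independence)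
      have hE1 := eigenline_one_of_block hϖ u γ g₁ u' hγu hadapt
      exact (eigenline_iff_of_latticeGraphIso_eq hvσ hσϖ hϖ u γ (one_mem _) hκ hdeep (by rw [← hc1, hc])).1 hE1
    · rintro ⟨⟨hadj, κ, hκ, hc, hnull⟩, hne⟩
      have hnE : ¬ (Valued.v (((((((u * κ : unitaryGroupOfForm σ ((StdForm.antidiagonal 3).over K)) : GL (Fin 3) K))⁻¹ : GL (Fin 3) K) : Matrix (Fin 3) (Fin 3) K) * (((γ : GL (Fin 3) K) : Matrix (Fin 3) (Fin 3) K) - 1) * (((u * κ : unitaryGroupOfForm σ ((StdForm.antidiagonal 3).over K)) : GL (Fin 3) K) : Matrix (Fin 3) (Fin 3) K)) 1 0) ≤ Valued.v ϖ ^ (d₀ + 1) ∧ Valued.v (((((((u * κ : unitaryGroupOfForm σ ((StdForm.antidiagonal 3).over K)) : GL (Fin 3) K))⁻¹ : GL (Fin 3) K) : Matrix (Fin 3) (Fin 3) K) * (((γ : GL (Fin 3) K) : Matrix (Fin 3) (Fin 3) K) - 1) * (((u * κ : unitaryGroupOfForm σ ((StdForm.antidiagonal 3).over K)) : GL (Fin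 3) K) : Matrix (Fin 3) (Fin 3) K)) 2 0) ≤ Valued.v ϖ ^ (d₀ + 1)) := fun hE =>
        hne (by rw [hc]; exact latticeGraphIso_eq_of_eigenline_of_shell hvσ hσϖ hϖ u γ g₁ u' hγu hadapt' hsym' hl' hκ hE)
      exact ⟨hadj, hchild c κ hadj hκ hc hnE, κ, hκ, hc, hnE, hnull⟩
  -- the TOP counts (this seat's ★ `…TopVertexLineCountsRamified`, shape `c = 0`): ONE null neighbour (`u·N₁` itself), `q·[χ(c₀l̄) = τ]` class neighbours
  have cE := ncard_children_null_eq_one_of_shape_top hσ hvσ hσϖ hϖ hres h2 u ((((u⁻¹ * γ * u : unitaryGroupOfForm σ ((StdForm.antidiagonal 3).over K)) : GL (Fin 3) K) : Matrix (Fin 3) (Fin 3) K) - 1) Y₀ hY₀ hc (0 : 𝓀[K]) hl hshape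
  have cP := ncard_children_quadraticChar_eq_of_shape_top hσ hvσ hσϖ hϖ hres h2 u ((((u⁻¹ * γ * u : unitaryGroupOfForm σ ((StdForm.antidiagonal 3).over K)) : GL (Fin 3) K) : Matrix (Fin 3) (Fin 3) K) - 1) Y₀ hY₀ hc (0 : 𝓀[K]) (IsLocalRing.residue 𝒪[K] LO) hshape
    ((IsLocalRing.residue 𝒪[K] nc₁)⁻¹) (τ := 1) (Or.inl rfl)
  have cM := ncard_children_quadraticChar_eq_of_shape_top hσ hvσ hσϖ hϖ hres h2 u ((((u⁻¹ * γ * u : unitaryGroupOfForm σ ((StdForm.antidiagonal 3).over K)) : GL (Fin 3) K) : Matrix (Fin 3) (Fin 3) K) - 1) Y₀ hY₀ hc (0 : 𝓀[K]) (IsLocalRing.residue 𝒪[K] LO) hshape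
    ((IsLocalRing.residue 𝒪[K] nc₁)⁻¹) (τ := -1) (Or.inr rfl)
  rw [← hNBnull] at cE
  rw [← hNBP] at cP
  rw [← hNBM] at cM
  -- removing the block neighbour `u·N₁` from the ONE null neighbour leaves no E-child
  have hEcard := Set.ncard_sdiff_singleton_of_mem hone_mem
  rw [← hE, cE] at hEcard
  refine ⟨?_, ?_, ?_⟩
  · rw [kE, hEcard, Nat.sub_self, mul_zero]
  · rw [kP, hP, hq, cP]
  · rw [kM, hM, hq, cM]

end Literature.NumberTheory.Rogawski1990.TypeOneRamifiedJunction

end
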